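import Summits.HodgeConjecture.HodgeConjecture.Theorems.TropicalKugaSatakeCayleyFormalCycleCriterionCycleClassRational
import HarnessLib

/-!
# Tropical `2`-cycle classes are tropical Hodge classes (Mikhalkin–Zharkov Thm. 5.4 for framed
# simplicial `2`-chains) — crux `EffectiveCayleyNonRealizability` (stmt-HodgeConjecture-18569)

Route `TropicalKugaSatakeCayley` of `HodgeConjecture`, chain encoding
`Literature.AlgebraicGeometry.Tropical.TropicalTorus.Chain` (any `g`, `p = 2`). The EIGENWAVE
`φ : ⋀² ⊗ ⋀² → ⋀¹ ⊗ ⋀³` (`TropicalTorus.eigenwave`, `q = 1`) moves one vector of the first factor of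
`e_K ⊗ e_J` into the second. The class of a framed `2`-cell is the rank-one tensor
`μ · (D₁ ∧ D₂) ⊗ (D₁ ∧ D₂)` (`Cell.classOf`: `vol⃗ ⊗ framing`, both multiples of the Plücker vector of
the direction frame `D`), and `φ` kills it: the `({a}, J)` entry of `φ(class)` is, up to the factor
`-μ`, the `J`-coordinate of `v ∧ D₁ ∧ D₂` with `v = D_{a1} D₂ - D_{a2} D₁ ∈ span(D₁, D₂)` — the
expansion of a `3 × 3` determinant with a column in the span of the other two (Mikhalkin–Zharkov,
Thm. 5.4: "any vector parallel to a simplex … turns to zero after the wedge product with the volume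
element"). Hence (`eigenwave_classOf`) the eigenwave kills the class of EVERY framed `2`-chain, and
(`cycleClass_mem_hodgeClasses`) the rational period class `M` of a tropical `2`-cycle of
`ℝ^g / P ℤ^g` (`compound 2 P⁻¹ · classOf = M`, `FormalCycleCriterion.cycleClassRational`) is a
tropical Hodge class: `M ∈ hodgeClasses P 1` — the ingredient "eigenwave kills cycle classes at each
parameter" of the rung `stub_rung_sixthDirection` and of the birth line's class space
`{M | ∀ t, eigenwave (compound 2 (ksMatrix t) * M) = 0}` of crux stmt-HodgeConjecture-18569.

Also: Cauchy–Binet for second compounds (`compound_two_mul`, from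
`FormalCycleCriterion.sum_minor_mul_pluecker`) and `compound_two_one`, so that
`compound 2 P * compound 2 P⁻¹ = 1` for invertible `P`.

No named fact, no new definition, no sorry.
References: [MikhalkinZharkov2014Eigenwave] G. Mikhalkin, I. Zharkov, Tropical eigenwave and
intermediate Jacobians, LN UMI 15 (2014), §5.1–5.2, Thm. 5.4; [Zharkov2020TropicalWeil] I. Zharkov,
Tropical abelian varieties, Weil classes and the Hodge conjecture, arXiv:2002.02347, p. 2.
-/

noncomputable section

-- `Summit.HodgeConjecture.HodgeConjecture.…` is the mandated namespace (single-conjunct summit).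
set_option linter.dupNamespace false

open scoped BigOperators Matrix

namespace Summit.HodgeConjecture.HodgeConjecture.Theorems.EffectiveCayleyNonRealizability

open Literature.AlgebraicGeometry.Tropical
open Literature.AlgebraicGeometry.Tropical.TropicalTorus
open Summit.HodgeConjecture.HodgeConjecture.Theorems.FormalCycleCriterion

section Eigenwave

variable {S : Type*} [CommRing S] {g : ℕ}

/-! ### Enumerating `3`-subsets -/

/-- Transport of the increasing enumeration along an equality of finite sets. [folklore] -/
theorem orderEmbOfFin_congr {s t : Finset (Fin g)} (hst : s = t) {k : ℕ} (hs : s.card = k)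
    (ht : t.card = k) (i : Fin k) : s.orderEmbOfFin hs i = t.orderEmbOfFin ht i := by
  subst hst; rfl

/-- Plücker coordinates only depend on the underlying finite set (transport of the cardinality
proof). [folklore] -/
theorem pluecker_congr (D : Matrix (Fin g) (Fin 2) S) {s t : Finset (Fin g)} (hst : s = t)
    (hs : s.card = 2) (ht : t.card = 2) : pluecker D ⟨s, hs⟩ = pluecker D ⟨t, ht⟩ := by
  subst hst; rfl

/-- The three elements `j₀ < j₁ < j₂` of a `3`-subset enumerate it. [folklore] -/
theorem triple_orderEmbOfFin_eq (J : Sub g 3) :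
    ({J.1.orderEmbOfFin J.2 0, J.1.orderEmbOfFin J.2 1, J.1.orderEmbOfFin J.2 2} : Finset (Fin g)) =
      J.1 := by
  ext x
  constructor
  · intro hx
    simp only [Finset.mem_insert, Finset.mem_singleton] at hx
    rcases hx with rfl | rfl | rfl <;> exact Finset.orderEmbOfFin_mem _ _ _
  · intro hx
    have hx' : x ∈ Set.range (J.1.orderEmbOfFin J.2) := by
      rw [Finset.range_orderEmbOfFin]; exact hx
    obtain ⟨i, rfl⟩ := hx'
    simp only [Finset.mem_insert, Finset.mem_singleton]
    fin_cases i
    · exact Or.inl rfl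
    · exact Or.inr (Or.inl rfl)
    · exact Or.inr (Or.inr rfl)

/-- The Plücker coordinate of a `g × 2` frame at a pair `{a < b}` written as a literal pair.
[folklore] -/
theorem pluecker_pair (D : Matrix (Fin g) (Fin 2) S) {a b : Fin g} (hab : a < b)
    (h : ({a, b} : Finset (Fin g)).card = 2) :
    pluecker D ⟨{a, b}, h⟩ = D a 0 * D b 1 - D a 1 * D b 0 := by
  rw [pluecker_two]
  obtain ⟨h0, h1⟩ := orderEmbOfFin_pair hab h
  simp only [h0, h1]

/-- **The signed pair coordinate.** For `a ≠ k`, the eigenwave sign `(-1)^{#{a' ∈ {a} : a' < k}}`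
times the Plücker coordinate at `insert k {a}` is `-(D_{a0} D_{k1} - D_{a1} D_{k0})` in either order of
`a, k`. [folklore] -/
theorem sign_mul_pluecker_insert (D : Matrix (Fin g) (Fin 2) S) {a k : Fin g} (hak : a ≠ k)
    (h : (insert k ({a} : Finset (Fin g))).card = 2) :
    (-1 : S) ^ (({a} : Finset (Fin g)).filter (· < k)).card * pluecker D ⟨insert k {a}, h⟩ =
      -(D a 0 * D k 1 - D a 1 * D k 0) := by
  rcases lt_or_gt_of_ne hak with hlt | hgt
  · -- `a < k`: the pair is `{a, k}`, the sign is `-1`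
    have hfil : ({a} : Finset (Fin g)).filter (· < k) = {a} := by
      ext x; simp only [Finset.mem_filter, Finset.mem_singleton]
      exact ⟨fun hx => hx.1, fun hx => ⟨hx, hx ▸ hlt⟩⟩
    have hset : insert k ({a} : Finset (Fin g)) = {a, k} := Finset.pair_comm k a
    have h' : ({a, k} : Finset (Fin g)).card = 2 := hset ▸ h
    have hpl : pluecker D ⟨insert k {a}, h⟩ = pluecker D ⟨{a, k}, h'⟩ := pluecker_congr D hset h h'
    rw [hfil, Finset.card_singleton, pow_one, hpl, pluecker_pair D hlt h']
    ring
  · -- `k < a`: the pair is `{k, a}`, the sign is `+1`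
    have hfil : ({a} : Finset (Fin g)).filter (· < k) = ∅ := by
      ext x; simp only [Finset.mem_filter, Finset.mem_singleton, Finset.notMem_empty, iff_false,
        not_and]
      intro hx; rw [hx]; exact not_lt.2 hgt.le
    rw [hfil, Finset.card_empty, pow_zero, one_mul, pluecker_pair D hgt h]
    ring

/-! ### The eigenwave kills rank-one Plücker tensors -/

open Classical in
/-- **The eigenwave kills `(D₁ ∧ D₂) ⊗ (D₁ ∧ D₂)`.** For a `g × 2` frame `D` over `S` and `μ ∈ S`,
`φ (μ · pl(D) ⊗ pl(D)) = 0`: the `({a}, {j₀ < j₁ < j₂})` entry is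
`-μ · Σ_m (-1)^m ω(a, j_m) ω(J ∖ j_m)` with `ω(a, k) = D_{a0} D_{k1} - D_{a1} D_{k0}`, the three-term
Plücker relation (a `3 × 3` determinant whose first column `ω(a, ·)` is a combination of the columns
`D_{·0}`, `D_{·1}`). [cite: MikhalkinZharkov2014Eigenwave, Thm. 5.4] -/
theorem eigenwave_rankOne_pluecker (D : Matrix (Fin g) (Fin 2) S) (μ : S) :
    eigenwave (q := 1)
        (Matrix.of fun K I : Sub g 2 => μ * pluecker D K * pluecker D I) = 0 := by
  ext K J
  rw [Matrix.zero_apply]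
  simp only [eigenwave, Matrix.of_apply]
  -- `K = {a}`, `J = {j₀ < j₁ < j₂}`
  obtain ⟨a, ha⟩ := Finset.card_eq_one.1 K.2
  set j : Fin 3 ↪o Fin g := J.1.orderEmbOfFin J.2 with hj
  have hJ : ({j 0, j 1, j 2} : Finset (Fin g)) = J.1 := triple_orderEmbOfFin_eq J
  have h01 : j 0 < j 1 := j.strictMono (by decide)
  have h12 : j 1 < j 2 := j.strictMono (by decide)
  have h02 : j 0 < j 2 := h01.trans h12
  -- the pair coordinate `ω`
  let ω : Fin g → Fin g → S := fun x y => D x 0 * D y 1 - D x 1 * D y 0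
  -- erased pairs and their Plücker coordinates
  have he0 : J.1.erase (j 0) = {j 1, j 2} := by
    rw [← hJ, Finset.erase_insert]
    simp only [Finset.mem_insert, Finset.mem_singleton, not_or]
    exact ⟨h01.ne, h02.ne⟩
  have he1 : J.1.erase (j 1) = {j 0, j 2} := by
    rw [← hJ, Finset.erase_insert_of_ne h01.ne, Finset.erase_insert]
    simp only [Finset.mem_singleton]; exact h12.ne
  have he2 : J.1.erase (j 2) = {j 0, j 1} := by
    rw [← hJ, Finset.erase_insert_of_ne h02.ne, Finset.erase_insert_of_ne h12.ne,
      Finset.erase_singleton]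
    rfl
  have hpe : ∀ (m : Fin 3) (x y : Fin g) (hxy : x < y) (he : J.1.erase (j m) = {x, y})
      (h : (J.1.erase (j m)).card = 2), pluecker D ⟨J.1.erase (j m), h⟩ = ω x y := by
    intro m x y hxy he h
    have h' : ({x, y} : Finset (Fin g)).card = 2 := he ▸ h
    rw [pluecker_congr D he h h', pluecker_pair D hxy h']
  -- positions inside `J`
  have hpos : ∀ m : Fin 3, (J.1.filter (· < j m)).card = (m : ℕ) := by
    intro m
    rw [← hJ]
    fin_cases m
    · have : ({j 0, j 1, j 2} : Finset (Fin g)).filter (· < j 0) = ∅ := by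
        ext x
        simp only [Finset.mem_filter, Finset.mem_insert, Finset.mem_singleton,
          Finset.notMem_empty, iff_false, not_and]
        rintro (rfl | rfl | rfl)
        · exact lt_irrefl _
        · exact not_lt.2 h01.le
        · exact not_lt.2 h02.le
      simp [this]
    · have : ({j 0, j 1, j 2} : Finset (Fin g)).filter (· < j 1) = {j 0} := by
        ext x
        simp only [Finset.mem_filter, Finset.mem_insert, Finset.mem_singleton]
        constructor
        · rintro ⟨rfl | rfl | rfl, hx⟩
          · rfl
          · exact absurd hx (lt_irrefl _)
          · exact absurd hx (not_lt.2 h12.le)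
        · rintro rfl; exact ⟨Or.inl rfl, h01⟩
      simp [this]
    · have : ({j 0, j 1, j 2} : Finset (Fin g)).filter (· < j 2) = {j 0, j 1} := by
        ext x
        simp only [Finset.mem_filter, Finset.mem_insert, Finset.mem_singleton]
        constructor
        · rintro ⟨rfl | rfl | rfl, hx⟩
          · exact Or.inl rfl
          · exact Or.inr rfl
          · exact absurd hx (lt_irrefl _)
        · rintro (rfl | rfl)
          · exact ⟨Or.inl rfl, h02⟩
          · exact ⟨Or.inr (Or.inl rfl), h12⟩
      simp [this, Finset.card_pair h01.ne]
  -- each summand at `k = j m`, uniformly (the case `a = j m` gives `0 = ω a a · …`)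
  have hterm : ∀ (m : Fin 3) (x y : Fin g), x < y → J.1.erase (j m) = {x, y} →
      (if h : j m ∉ K.1 ∧ j m ∈ J.1 then
          (-1 : S) ^ ((K.1.filter (· < j m)).card + (J.1.filter (· < j m)).card) *
            (μ * pluecker D ⟨insert (j m) K.1, by rw [Finset.card_insert_of_notMem h.1, K.2]⟩ *
              pluecker D ⟨J.1.erase (j m), by rw [Finset.card_erase_of_mem h.2, J.2]⟩)
        else 0) =
        -(μ * ((-1 : S) ^ (m : ℕ) * (ω a (j m) * ω x y))) := by
    intro m x y hxy he
    have hmem : j m ∈ J.1 := Finset.orderEmbOfFin_mem _ _ _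
    by_cases ham : a = j m
    · -- `a = j m`: no summand, and `ω a a = 0`
      have hnot : ¬(j m ∉ K.1 ∧ j m ∈ J.1) := fun h => h.1 (by rw [ha, ← ham]; simp)
      rw [dif_neg hnot, ← ham]
      simp only [ω]; ring
    · have hcond : j m ∉ K.1 ∧ j m ∈ J.1 := ⟨by rw [ha]; simpa using Ne.symm ham, hmem⟩
      rw [dif_pos hcond, pow_add, hpos m]
      have hcard : (insert (j m) ({a} : Finset (Fin g))).card = 2 := by
        rw [Finset.card_insert_of_notMem (by simpa using Ne.symm ham), Finset.card_singleton]
      have hK1 : (-1 : S) ^ (K.1.filter (· < j m)).card *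
          pluecker D ⟨insert (j m) K.1, by rw [Finset.card_insert_of_notMem hcond.1, K.2]⟩ =
          -(ω a (j m)) := by
        have e : pluecker D ⟨insert (j m) K.1, by rw [Finset.card_insert_of_notMem hcond.1, K.2]⟩ =
            pluecker D ⟨insert (j m) {a}, hcard⟩ := pluecker_congr D (by rw [ha]) _ hcard
        rw [e]
        have := sign_mul_pluecker_insert D ham hcard
        rw [ha]
        exact this
      rw [hpe m x y hxy he]
      calc (-1 : S) ^ (K.1.filter (· < j m)).card * (-1 : S) ^ (m : ℕ) *
            (μ * pluecker D ⟨insert (j m) K.1, _⟩ * ω x y)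
          = (-1 : S) ^ (m : ℕ) * μ * ω x y *
              ((-1 : S) ^ (K.1.filter (· < j m)).card * pluecker D ⟨insert (j m) K.1, _⟩) := by
            ring
        _ = -(μ * ((-1 : S) ^ (m : ℕ) * (ω a (j m) * ω x y))) := by rw [hK1]; ring
  -- restrict the sum to `J = {j 0, j 1, j 2}` and expand
  rw [← Finset.sum_subset (Finset.subset_univ J.1) (fun k _ hk => by rw [dif_neg (fun h => hk h.2)])]
  rw [← Finset.sum_congr hJ (fun _ _ => rfl)]
  have hn0 : j 0 ∉ ({j 1, j 2} : Finset (Fin g)) := by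
    simp only [Finset.mem_insert, Finset.mem_singleton, not_or]; exact ⟨h01.ne, h02.ne⟩
  have hn1 : j 1 ∉ ({j 2} : Finset (Fin g)) := by
    simp only [Finset.mem_singleton]; exact h12.ne
  rw [Finset.sum_insert hn0, Finset.sum_insert hn1, Finset.sum_singleton,
    hterm 0 (j 1) (j 2) h12 he0, hterm 1 (j 0) (j 2) h02 he1, hterm 2 (j 0) (j 1) h01 he2]
  simp only [ω, Fin.val_zero, Fin.val_one, Fin.val_two, pow_zero, pow_one]
  ring

/-! ### Classes of framed `2`-chains are killed by the eigenwave -/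

/-- Plücker coordinates commute with ring maps (determinants do). [folklore] -/
theorem pluecker_map_ringHom {R : Type*} [CommRing R] (f : R →+* S) (D : Matrix (Fin g) (Fin 2) R)
    (K : Sub g 2) : pluecker (D.map f) K = f (pluecker D K) := by
  unfold pluecker
  rw [RingHom.map_det, Matrix.submatrix_map]
  rfl

/-- The eigenwave of a finite sum is the sum of the eigenwaves. [folklore] -/
theorem eigenwave_finset_sum {ι : Type*} (s : Finset ι) {q : ℕ}
    (C : ι → Matrix (Sub g (q + 1)) (Sub g (q + 1)) S) :
    eigenwave (∑ i ∈ s, C i) = ∑ i ∈ s, eigenwave (C i) := by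
  classical
  induction s using Finset.induction_on with
  | empty => simp [eigenwave_zero]
  | insert a s ha ih => rw [Finset.sum_insert ha, Finset.sum_insert ha, eigenwave_add, ih]

variable [Algebra ℚ S]

/-- The class of a framed `2`-cell is the rank-one Plücker tensor
`(weight/2 · det coef) · pl(D) ⊗ pl(D)` of its (base-changed) direction frame. [folklore] -/
theorem classOf_cell_eq_rankOne (c : Cell S g 2) :
    c.classOf = Matrix.of fun K I : Sub g 2 =>
      (algebraMap ℚ S (c.weight / 2) * c.coef.det) *
        pluecker (c.dir.map (algebraMap ℚ S)) K * pluecker (c.dir.map (algebraMap ℚ S)) I := by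
  ext K I
  simp only [Cell.classOf, Cell.framing, Matrix.of_apply, pluecker_map_ringHom, map_mul,
    Nat.factorial_two, Nat.cast_ofNat, div_eq_mul_inv]
  ring

/-- **The eigenwave kills the class of every framed `2`-cell** (Mikhalkin–Zharkov Thm. 5.4, cell
level). [cite: MikhalkinZharkov2014Eigenwave, Thm. 5.4] -/
theorem eigenwave_classOf_cell (c : Cell S g 2) : eigenwave (q := 1) c.classOf = 0 := by
  rw [classOf_cell_eq_rankOne]
  exact eigenwave_rankOne_pluecker _ _

/-- **The eigenwave kills the class of every framed `2`-chain** (cycle or not: the vanishing is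
cell by cell). [cite: MikhalkinZharkov2014Eigenwave, Thm. 5.4] [cite: Zharkov2020TropicalWeil, p. 2] -/
theorem eigenwave_classOf (Z : Chain S g 2) : eigenwave (q := 1) Z.classOf = 0 := by
  unfold Chain.classOf
  rw [eigenwave_finset_sum]
  exact Finset.sum_eq_zero fun c _ => eigenwave_classOf_cell _

end Eigenwave

/-! ### Second compounds: Cauchy–Binet and the identity -/

section Compound

variable {S : Type*} [CommRing S] {g : ℕ}

/-- **Cauchy–Binet for second compounds**: `compound 2 (A * B) = compound 2 A * compound 2 B`
(from the `2 × 2`-minor Cauchy–Binet `FormalCycleCriterion.sum_minor_mul_pluecker`, applied to the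
frame of the two `J`-columns of `B`). [folklore] -/
theorem compound_two_mul (A B : Matrix (Fin g) (Fin g) S) :
    compound 2 (A * B) = compound 2 A * compound 2 B := by
  ext I J
  rw [Matrix.mul_apply]
  simp only [compound, Matrix.of_apply]
  -- the `J`-columns of `B` as a `g × 2` frame
  have hB : ∀ K : Sub g 2, minor B K J = pluecker (B.submatrix id (J.1.orderEmbOfFin J.2)) K :=
    fun K => rfl
  have hAB : minor (A * B) I J = pluecker (A * B.submatrix id (J.1.orderEmbOfFin J.2)) I := by
    unfold minor pluecker
    congr 1
  simp only [hB, hAB]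
  rw [sum_minor_mul_pluecker]

/-- The second compound of the identity is the identity. [folklore] -/
theorem compound_two_one : compound 2 (1 : Matrix (Fin g) (Fin g) S) = 1 := by
  ext I J
  simp only [compound, Matrix.of_apply, minor]
  by_cases hIJ : I = J
  · -- diagonal: the submatrix of `1` along one injective enumeration is `1`
    subst hIJ
    have h1 : (1 : Matrix (Fin g) (Fin g) S).submatrix (I.1.orderEmbOfFin I.2) (I.1.orderEmbOfFin I.2) =
        (1 : Matrix (Fin 2) (Fin 2) S) := by
      ext i i'
      simp only [Matrix.submatrix_apply, Matrix.one_apply,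
        (I.1.orderEmbOfFin I.2).injective.eq_iff]
    rw [h1, Matrix.det_one, Matrix.one_apply_eq]
  · -- off-diagonal: some column of `J` lies outside `I`, so that column of the submatrix vanishes
    rw [Matrix.one_apply_ne hIJ]
    have hex : ∃ c : Fin 2, J.1.orderEmbOfFin J.2 c ∉ I.1 := by
      by_contra hall
      push Not at hall
      apply hIJ
      apply Subtype.ext
      symm
      refine Finset.eq_of_subset_of_card_le (fun x hx => ?_) (by rw [I.2, J.2])
      have hx' : x ∈ Set.range (J.1.orderEmbOfFin J.2) := by
        rw [Finset.range_orderEmbOfFin]; exact hx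
      obtain ⟨c, rfl⟩ := hx'
      exact hall c
    obtain ⟨c, hc⟩ := hex
    refine Matrix.det_eq_zero_of_column_eq_zero c fun i => ?_
    simp only [Matrix.submatrix_apply, Matrix.one_apply]
    rw [if_neg]
    intro h
    exact hc (h ▸ Finset.orderEmbOfFin_mem _ _ i)

/-- For a matrix with invertible determinant, `compound 2 P * compound 2 P⁻¹ = 1`. [folklore] -/
theorem compound_two_mul_nonsing_inv (P : Matrix (Fin g) (Fin g) S) (hP : IsUnit P.det) :
    compound 2 P * compound 2 P⁻¹ = 1 := by
  rw [← compound_two_mul, Matrix.mul_nonsing_inv P hP, compound_two_one]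

end Compound

/-! ### Period classes of tropical `2`-cycles are tropical Hodge classes -/

/-- **The period class of a tropical `2`-cycle is a tropical Hodge class** (Mikhalkin–Zharkov
Thm. 5.4 with Prop. 4.3, chain encoding, any `g`): for a positive definite period matrix `P` and a
framed simplicial `2`-chain `Z` of `ℝ^g` with vanishing boundary modulo `P ℤ^g`, the period class
`compound 2 P⁻¹ · Z.classOf` is a RATIONAL matrix `M` (`cycleClassRational`) lying in
`hodgeClasses P 1`, i.e. `eigenwave (compound 2 P · M) = eigenwave (Z.classOf) = 0`.
[cite: MikhalkinZharkov2014Eigenwave, Thm. 5.4] [cite: Zharkov2020TropicalWeil, p. 2] -/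
theorem cycleClass_mem_hodgeClasses {g : ℕ} (P : Matrix (Fin g) (Fin g) ℝ) (hP : P.PosDef)
    (Z : Chain ℝ g 2) (hZ : Z.IsCycle P) :
    ∃ M ∈ hodgeClasses P 1, compound 2 P⁻¹ * Z.classOf = M.map (algebraMap ℚ ℝ) := by
  obtain ⟨M, hM⟩ := cycleClassRational P hP Z hZ
  refine ⟨M, ?_, hM⟩
  have hdet : IsUnit P.det := isUnit_iff_ne_zero.2 hP.det_pos.ne'
  show eigenwave (compound 2 P * M.map (algebraMap ℚ ℝ)) = 0
  rw [← hM, ← Matrix.mul_assoc, compound_two_mul_nonsing_inv P hdet, Matrix.one_mul]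
  exact eigenwave_classOf Z

/-- **Every class in the span of effective (or arbitrary) tropical `2`-cycle classes is killed by the
eigenwave**: the V-coordinate class space `effectiveSpan P 2` lies in the kernel of `φ`.
[cite: MikhalkinZharkov2014Eigenwave, Thm. 5.4] -/
theorem eigenwave_eq_zero_of_mem_effectiveSpan {g : ℕ} (P : Matrix (Fin g) (Fin g) ℝ)
    {C : Matrix (Sub g 2) (Sub g 2) ℝ} (hC : C ∈ effectiveSpan P 2) : eigenwave (q := 1) C = 0 := by
  refine Submodule.span_induction (p := fun C _ => eigenwave (q := 1) C = 0) ?_ ?_ ?_ ?_ hC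
  · rintro _ ⟨Z, -, -, rfl⟩
    exact eigenwave_classOf Z
  · exact eigenwave_zero
  · intro x y _ _ hx hy
    rw [eigenwave_add, hx, hy, add_zero]
  · intro r x _ hx
    have : (r • x : Matrix (Sub g 2) (Sub g 2) ℝ) = (r : ℝ) • x := by
      ext i j; simp [Rat.smul_def]
    rw [this, eigenwave_smul, hx, smul_zero]

end Summit.HodgeConjecture.HodgeConjecture.Theorems.EffectiveCayleyNonRealizability

end
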